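import Summits.QuantumFields.QCD.Theses.EulerDescent

/-!
# Crux `RayDescent` (stmt-QuantumFields-16900), negative side — the trivial slices

Refuter crux-attack record (route `EulerDescent`, sub-problem QCD). Three kernel-checked facts that
locate where the content of `Summit.QuantumFields.QCD.Theses.EulerDescent.RayDescent` is NOT:

* `corner_unsat_zero` / `not_eventually_corner_zero`: at `N_f = 0` the degenerate bare tuple
  `fun _ : Fin 0 => μ` does not depend on `μ`, so the crux's "non-massive set" at any coupling is `∅` or
  `univ` and has no least upper bound — the corner hypothesis is unsatisfiable and the `N_f = 0` slice of
  the crux is vacuous (neither a refutation nor evidence: the route uses `N_f ∈ {2, 3}`).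
* `hasLatticeMassGap_mono` / `descent_slice_one`: the uniform lattice gap is monotone in the rate, so the
  `l = 1` slice of the crux's conclusion holds for EVERY regularisation with no hypothesis; all content
  sits at `l > 1`.
* `mq_eq_of_rescaled`, `pin_eq_of_rescaled`, `gap_iff_of_rescaled`: the normalisation probe — a
  rescaling `(a, Z_m) ↦ (c a, c Z_m)` keeps
  every bare trajectory, `β` and `L` (the same lattice theories) and the pin ratio, and rescales the rate
  `Δ ↦ c Δ`; hypotheses and conclusion of the crux are covariant, so the free constants of
  `HasMassScaling` / `HasAsymptoticScaling` open no asymmetric loophole.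

No hypothesis of the crux is dischargeable in the present tree for `N_f ≥ 1` (the corner is the least
upper bound of a set defined by honest lattice clustering), so no unconditional `¬ RayDescent` can be
written without first constructing the Wilson corner. Standard material. [folklore]
-/

noncomputable section

open Filter
open Literature.MathematicalPhysics.QuantumFieldTheory

namespace Summit.QuantumFields.QCD.Theorems.RayDescentNegative

/-- At `N_f = 0` the crux's massiveness clause does not depend on the (empty) degenerate mass tuple.
[folklore] -/
theorem massive_zero_indep (β μ μ' : ℝ)
    (h : ∀ (R R' : ℕ) (A : QCDLatticeObservable 0 R) (B : QCDLatticeObservable 0 R'),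
      ∃ (C δ : ℝ) (S₀ : ℕ), 0 < δ ∧ ∀ S : ℕ, S₀ ≤ S → ∀ n : ℕ, n ≤ S →
        ‖qcdLatticeConnectedCorr β (2 * S + 1) (fun _ : Fin 0 => μ) A B n‖ ≤ C * Real.exp (-(δ * n))) :
    ∀ (R R' : ℕ) (A : QCDLatticeObservable 0 R) (B : QCDLatticeObservable 0 R'),
      ∃ (C δ : ℝ) (S₀ : ℕ), 0 < δ ∧ ∀ S : ℕ, S₀ ≤ S → ∀ n : ℕ, n ≤ S →
        ‖qcdLatticeConnectedCorr β (2 * S + 1) (fun _ : Fin 0 => μ') A B n‖ ≤ C * Real.exp (-(δ * n)) := by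
  have hconst : (fun _ : Fin 0 => μ') = (fun _ : Fin 0 => μ) := by
    funext i; exact i.elim0
  intro R R' A B
  obtain ⟨C, δ, S₀, hδ, hb⟩ := h R R' A B
  refine ⟨C, δ, S₀, hδ, fun S hS n hn => ?_⟩
  rw [hconst]
  exact hb S hS n hn

/-- **`N_f = 0`: the corner hypothesis of `RayDescent` is unsatisfiable** — the crux's non-massive set
(verbatim) is `∅` or `univ` at `N_f = 0`, neither of which has a least upper bound in `ℝ`. [folklore] -/
theorem corner_unsat_zero (β c : ℝ) :
    ¬ IsLUB {μ : ℝ | ¬ (∀ (R R' : ℕ) (A : QCDLatticeObservable 0 R) (B : QCDLatticeObservable 0 R'),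
      ∃ (C δ : ℝ) (S₀ : ℕ), 0 < δ ∧ ∀ S : ℕ, S₀ ≤ S → ∀ n : ℕ, n ≤ S →
        ‖qcdLatticeConnectedCorr β (2 * S + 1) (fun _ : Fin 0 => μ) A B n‖ ≤ C * Real.exp (-(δ * n)))} c := by
  intro h
  set T : Set ℝ := {μ : ℝ | ¬ (∀ (R R' : ℕ) (A : QCDLatticeObservable 0 R) (B : QCDLatticeObservable 0 R'),
      ∃ (C δ : ℝ) (S₀ : ℕ), 0 < δ ∧ ∀ S : ℕ, S₀ ≤ S → ∀ n : ℕ, n ≤ S →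
        ‖qcdLatticeConnectedCorr β (2 * S + 1) (fun _ : Fin 0 => μ) A B n‖ ≤ C * Real.exp (-(δ * n)))}
    with hT
  by_cases hne : T.Nonempty
  · obtain ⟨μ₀, hμ₀⟩ := hne
    have hmem : c + 1 ∈ T := by
      rw [hT] at hμ₀ ⊢
      exact fun hM => hμ₀ (massive_zero_indep β (c + 1) μ₀ hM)
    have := h.1 hmem
    linarith
  · rw [Set.not_nonempty_iff_eq_empty] at hne
    rw [hne] at h
    have h2 : c - 1 ∈ upperBounds (∅ : Set ℝ) := fun x hx => hx.elim
    have := h.2 h2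
    linarith

/-- The `N_f = 0` slice of the crux is vacuous: for no regularisation and no candidate corner does
the corner clause hold eventually (verbatim the crux's first hypothesis at `N_f = 0`). [folklore] -/
theorem not_eventually_corner_zero (reg : QCDRegularisation 0) (mc : ℕ → ℝ) :
    ¬ (∀ᶠ k in atTop, IsLUB {μ : ℝ | ¬ (∀ (R R' : ℕ) (A : QCDLatticeObservable 0 R)
      (B : QCDLatticeObservable 0 R'), ∃ (C δ : ℝ) (S₀ : ℕ), 0 < δ ∧ ∀ S : ℕ, S₀ ≤ S →
        ∀ n : ℕ, n ≤ S → ‖qcdLatticeConnectedCorr (reg.β k) (2 * S + 1) (fun _ : Fin 0 => μ) A B n‖ ≤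
          C * Real.exp (-(δ * n)))} (mc k)) := by
  intro h
  obtain ⟨k, hk⟩ := h.exists
  exact corner_unsat_zero (reg.β k) (mc k) hk

/-- **Monotonicity of the uniform lattice gap in the rate** (a negative constant `C` is pointwise
contradictory, so `max C 0` serves as the new constant). [folklore] -/
theorem hasLatticeMassGap_mono {Nf : ℕ} (sch : QCDScheme Nf) {Δ Δ' : ℝ}
    (h : sch.HasLatticeMassGap Δ) (hle : Δ' ≤ Δ) : sch.HasLatticeMassGap Δ' := by
  intro R R' A B
  obtain ⟨C, hC⟩ := h R R' A B
  refine ⟨max C 0, ?_⟩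
  filter_upwards [hC] with k hk S hS n hn
  have h1 := hk S hS n hn
  have han : 0 ≤ sch.a k * n := mul_nonneg (sch.a_pos k).le (Nat.cast_nonneg n)
  have hexp : Real.exp (-(Δ * (sch.a k * n))) ≤ Real.exp (-(Δ' * (sch.a k * n))) := by
    apply Real.exp_le_exp.2
    nlinarith
  calc ‖qcdLatticeConnectedCorr (sch.β k) (2 * S + 1) (fun fl => sch.mq fl k) A B n‖
      ≤ C * Real.exp (-(Δ * (sch.a k * n))) := h1
    _ ≤ max C 0 * Real.exp (-(Δ * (sch.a k * n))) :=
        mul_le_mul_of_nonneg_right (le_max_left _ _) (Real.exp_pos _).le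
    _ ≤ max C 0 * Real.exp (-(Δ' * (sch.a k * n))) :=
        mul_le_mul_of_nonneg_left hexp (le_max_right _ _)

/-- **The `l = 1` slice of the crux's conclusion is free**: for EVERY regularisation (no corner, pin,
scaling or branch hypothesis), a uniform gap `Δ` at the tuple `1 • m` gives every rate `Δ' < Δ / 1` at
`m`. All content of `RayDescent` sits at `l > 1`. [folklore] -/
theorem descent_slice_one {Nf : ℕ} (reg : QCDRegularisation Nf) (m : Fin Nf → ℝ) (Δ : ℝ)
    (h : (reg.scheme (fun f => (1 : ℝ) * m f) 0 0).HasLatticeMassGap Δ) (Δ' : ℝ)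
    (hlt : Δ' < Δ / 1) : (reg.scheme m 0 0).HasLatticeMassGap Δ' := by
  have hm : (fun f => (1 : ℝ) * m f) = m := funext fun f => one_mul (m f)
  rw [hm] at h
  rw [div_one] at hlt
  exact hasLatticeMassGap_mono _ h hlt.le

section Rescale

variable {Nf : ℕ} (reg reg' : QCDRegularisation Nf) (c : ℝ)
  (ha : ∀ k, reg'.a k = c * reg.a k) (hZ : ∀ k, reg'.Zm k = c * reg.Zm k)
  (hcrit : ∀ k, reg'.mcrit k = reg.mcrit k)

include ha hZ hcrit in
/-- A rescaled regularisation `(a, Z_m) ↦ (c a, c Z_m)` (same `m_crit`) has the SAME bare trajectories: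
the same lattice theories are compared. [folklore] -/
theorem mq_eq_of_rescaled (hc : c ≠ 0) (m : Fin Nf → ℝ) (f : Fin Nf) (k : ℕ) :
    (reg'.scheme m 0 0).mq f k = (reg.scheme m 0 0).mq f k := by
  simp only [QCDRegularisation.scheme_mq, ha, hZ, hcrit]
  have hZk : reg.Zm k ≠ 0 := (reg.Zm_pos k).ne'
  field_simp

include ha hZ hcrit in
/-- … and the same pin ratio `(m_crit − mc)·Z_m/a` for every candidate corner `mc` (the corner clause
reads only `β`; mass scaling gains the factor `c`; asymptotic scaling trades `Λ` for `Λ/c`). [folklore] -/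
theorem pin_eq_of_rescaled (hc : c ≠ 0) (mc : ℕ → ℝ) (k : ℕ) :
    (reg'.mcrit k - mc k) * reg'.Zm k / reg'.a k = (reg.mcrit k - mc k) * reg.Zm k / reg.a k := by
  rw [ha, hZ, hcrit]
  have hak : reg.a k ≠ 0 := (reg.a_pos k).ne'
  field_simp

include ha hZ hcrit in
/-- **Normalisation probe**: with the same `β` and `L`, the uniform gap of the rescaled regularisation at
rate `Δ` is the gap of the original at rate `c Δ` — the conclusion of the crux is covariant under the
rescaling that fixes all its hypotheses, the factor being absorbed by `∀ Δ`. [folklore] -/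
theorem gap_iff_of_rescaled (hc : c ≠ 0) (hβ : ∀ k, reg'.β k = reg.β k) (hL : ∀ k, reg'.L k = reg.L k)
    (m : Fin Nf → ℝ) (Δ : ℝ) :
    (reg'.scheme m 0 0).HasLatticeMassGap Δ ↔ (reg.scheme m 0 0).HasLatticeMassGap (c * Δ) := by
  unfold QCDScheme.HasLatticeMassGap
  have hmq : ∀ k, (fun fl => (reg'.scheme m 0 0).mq fl k) = fun fl => (reg.scheme m 0 0).mq fl k :=
    fun k => funext fun fl => mq_eq_of_rescaled reg reg' c ha hZ hcrit hc m fl k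
  have key : ∀ (k n : ℕ), Real.exp (-(Δ * ((reg'.scheme m 0 0).a k * n))) =
      Real.exp (-((c * Δ) * ((reg.scheme m 0 0).a k * n))) := by
    intro k n
    show Real.exp (-(Δ * (reg'.a k * n))) = Real.exp (-((c * Δ) * (reg.a k * n)))
    rw [ha]; ring_nf
  have hβ' : ∀ k, (reg'.scheme m 0 0).β k = (reg.scheme m 0 0).β k := hβ
  have hL' : ∀ k, (reg'.scheme m 0 0).L k = (reg.scheme m 0 0).L k := hL
  constructor
  · intro h R R' A B
    obtain ⟨C, hC⟩ := h R R' A B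
    refine ⟨C, ?_⟩
    filter_upwards [hC] with k hk S hS n hn
    have h1 := hk S (by rw [hL']; exact hS) n hn
    rw [key k n, hmq k, hβ'] at h1
    exact h1
  · intro h R R' A B
    obtain ⟨C, hC⟩ := h R R' A B
    refine ⟨C, ?_⟩
    filter_upwards [hC] with k hk S hS n hn
    have h1 := hk S (by rw [← hL']; exact hS) n hn
    rw [key k n, hmq k, hβ']
    exact h1

end Rescale

end Summit.QuantumFields.QCD.Theorems.RayDescentNegative

end
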